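import Literature.MathematicalPhysics.QuantumFieldTheory.LaportaRemiddi1996.AnalyticCoefficients

/-!
# `ζ(4) = π⁴/90` for the tree's series `LaportaRemiddi1996.zeta`

HONEST FRAMING: independent recomputation; certified where stated, statistical where stated; no new-physics claim.

Cell `pub-qed`, unit `pub-qed-lit`: the value `ζ(4) = π⁴/90` for the series `zeta k = Σ' n, 1/n^k` typed in
`Literature/…/LaportaRemiddi1996/AnalyticCoefficients.lean` (which proves `zeta_two` the same way),
transported from Mathlib's `riemannZeta_four` via `LaportaRemiddi1996.ofReal_zeta`. Used by the n = 3 and n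
= 4 bubble-chain theorems (`TripleBubble.lean`, `QuadrupleBubble.lean`). [folklore]
-/

noncomputable section

open Real Set MeasureTheory intervalIntegral Filter Topology

namespace Summit.Ventures.QEDPrecision.BubbleChains

open Literature.MathematicalPhysics.QuantumFieldTheory.LaportaRemiddi1996 (zeta ofReal_zeta)

/-- `ζ(4) = π⁴/90` for the tree's series `zeta` (from Mathlib's `riemannZeta_four`). [folklore] -/
theorem zeta_four : zeta 4 = π ^ 4 / 90 := by
  have h := ofReal_zeta (k := 4) (by norm_num)
  rw [show ((4 : ℕ) : ℂ) = 4 by norm_num, riemannZeta_four] at h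
  exact_mod_cast h

end Summit.Ventures.QEDPrecision.BubbleChains

end
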